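/-
Origin: expansion seat `planner-pub-hodgecm-pv01-0`, handover amended 2026-08-18T04:09:05Z (`HOME/pub-hodgecm-pv01/lean/Pv01/GaloisB3.lean`, md5 dd8f51e8, 355 lines);
landed by the gen-5 packager in gate run 21 as `HodgeCM/PerL34/GaloisB3.lean` (verbatim).
-/
/-
Origin: HOME/pub-hodgecm-pv01/lean/Pv01/GaloisB3.lean (module `Pv01.GaloisB3`; the packager renames to
`HodgeCM.PerL34.GaloisB3`) — session planner-pub-hodgecm-pv01-0 (unit pub-hodgecm-pv01, DAG-NODE PROVER #01).
DAG node (HOME/LEMMAS.md v2 §1): N03 (PerL v5 Lemma 2.1 `lem:reflex`, tex ll. 125–167), clause (b)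
"as `Φ_t` is primitive [Y1neg, Lemma 7.1(b)], `L^{H'} = K` and `H' = H`", together with the standing facts of
PerL §1.2 ll. 49–50 quoted from [Y1neg] Lemma 7.1 ("|H| = 4 resp. 8 …, all eight CM types of K are primitive").
[Y1neg] is NOT citable in this cell; this file replaces the citation by a KERNEL COMPUTATION in the
hyperoctahedral group `W(B₃) ≤ 𝔖₆`.  Pure Mathlib + the A11 port `HodgeCM.Prior.ReflexLemma` (for the hook).
-/
import Mathlib
import Summits.HodgeConjecture.HodgeCM.Prior.ReflexLemma

set_option autoImplicit false

/-!
# [Y1neg] Lemma 7.1(a)(b) and the primitivity step of PerL Lemma 2.1(b) as finite computations in `W(B₃)`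

## The texts (VERBATIM)

PerL v5 ll. 47–50: "`\cG:=\Gal(L/\Q)`, and complex conjugation `c\in\cG` is central. We fix `L\subset\ol\Q\subset\C`
and identify `\Hom(L,\C)=\cG`, the inclusion corresponding to `1`. Put `H:=\Gal(L/K)`, so `K=L^H`, and
`\varphi_1:=1|_K`; by [Y1neg, Lemma 7.1], `|H|=4` resp. `8` (for `[L:\Q]=24` resp. `48`), `K` contains no imaginary
quadratic field, and all eight CM types of `K` are primitive."

PerL v5 Lemma 2.1(b), proof ll. 153–156: "The right stabiliser `H':=\{u:\widetilde\Phi_tu=\widetilde\Phi_t\}` contains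
`H`; … `\Phi_t` … is induced from the CM type `\widetilde\Phi_t|_{L^{H'}}` of the subfield `L^{H'}\subseteq K`; as
`\Phi_t` is primitive [Y1neg, Lemma 7.1(b)], `L^{H'}=K` and `H'=H`."

[Y1neg] v2 Lemma 7.1 (ll. 211–216): "Assume ([L:ℚ] ∈ {24,48}). (a) If `[\widetilde K:\Q]=48` then `\mathcal G=W(B_3)`; if
`[\widetilde K:\Q]=24` then `K_0` is cyclic and `\mathcal G=\{\pm1\}^3\rtimes\Z/3`. (b) `K` contains no imaginary quadratic
field and no proper CM subfield; all eight CM types of `K` are primitive … Proof. (a) `N:=\mathcal G\cap\{\pm1\}^3` is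
normal in `\mathcal G` … So `|\mathcal G|=|N|\cdot|I|\in\{6,12,24,48\}` with `|\mathcal G|=24` only for `(|N|,|I|)=(8,3)` and
`48` only for `(8,6)`."

## Dictionary (Galois theory replaced by its permutation image — the same convention as `HodgeCM.Prior.ReflexLemma`)

* `Fin 6` = `Hom(K, ℂ)`: `a ∈ {0,1,2}` is `φ_{a+1}`, `a + 3` is `\bar φ_{a+1}`; the base point `φ₁ = 1|_K` is `0`.
* `cc : Perm (Fin 6)`, `i ↦ i + 3`, is post-composition with complex conjugation; `𝒢 = Gal(L/ℚ)` acts faithfully on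
  `Hom(K,ℂ)` (`L` is the normal closure of `K`) and, `c` being central (PerL l. 47), through permutations commuting
  with `cc`: `𝒢 ≤ W := C_{𝔖₆}(cc) = W(B₃)` (`card_W : Nat.card W = 48`), with `cc ∈ 𝒢` and `Nat.card 𝒢 = [L:ℚ] ∈ {24, 48}`
  (`IsGalois.card_aut_eq_finrank`).
* `H = Gal(L/K)` = the stabiliser of the point `0`; a CM type `Φ_t ∋ φ₁` of `K` = a finset `Φ ⊆ Fin 6` with
  `a ∈ Φ ↔ cc a ∉ Φ` and `0 ∈ Φ` (`IsCMType`); `\widetilde Φ_t = {g ∈ 𝒢 : g|_K ∈ Φ_t}` = `tilde 𝒢 Φ = {g : g 0 ∈ Φ}`.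
* "`Φ_t` is primitive, hence `H' = H`" = `rightStab (tilde 𝒢 Φ) = Stab(0) ⊓ 𝒢` (`rightStab_tilde_eq`, stated with
  the right-stabiliser SUBGROUP `RfwfReflex.rightStab` of the A11 port, whose `K' := L^{H'}` is thereby `K`).

## What is proved (kernel; the finite checks by `decide` in `𝔖₆`)

* `card_W` — `|W(B₃)| = 48`.
* `flips_mem` — **[Y1neg] L7.1(a), the part used:** every `𝒢 ≤ W` with `cc ∈ 𝒢` and `|𝒢| ∈ {24, 48}` contains the
  three "sign changes" `f0 f1 f2` (i.e. `N = {±1}³ ≤ 𝒢`).  Proof: `|𝒢| = 48 ⇒ 𝒢 = W`; `|𝒢| = 24 ⇒ [W:𝒢] = 2 ⇒ 𝒢 ∋ w²`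
  for all `w ∈ W` (`Subgroup.mul_self_mem_of_index_two`), and `f_b = cc · (f_j s)²` for a pair-transposition `s`.
  In full (**L7.1(a)**): `eq_W_of_card` (`|𝒢| = 48 ⇒ 𝒢 = W(B₃)`) and `coe_eq_words_of_card` (`|𝒢| = 24 ⇒ 𝒢` is the
  explicit set `{f0^a f1^b f2^c rot^k} = {±1}³ ⋊ ℤ/3`); transitivity of `𝒢` is not even needed.
* `rstab_iff_fix`, `rightStab_tilde_eq` — **primitivity ⇒ `H' = H` (PerL L2.1(b) / [Y1neg] L7.1(b)):** if
  `f1, f2 ∈ 𝒢` then for every CM type `Φ ∋ 0` and `u ∈ 𝒢`: (`∀ x ∈ 𝒢, (x u)(0) ∈ Φ ↔ x(0) ∈ Φ`) `↔ u 0 = 0`.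
* `no_index_two_over_stab` — **"`K` contains no (imaginary) quadratic field" ([Y1neg] L7.1(b)):** no subgroup `M`
  with `Stab_𝒢(0) ≤ M ≤ 𝒢` has index `2` in `𝒢` (24 resp. 48 explicit words in `M` versus `|M| = |𝒢|/2`).

Residual inputs, all standard Galois theory / Mathlib (none internal): faithfulness of `Gal(L/ℚ)` on `Hom(K,ℂ)`,
centrality of `c` for the CM field `L`, `|Gal(L/ℚ)| = [L:ℚ]`, `Gal(L/K) = Stab(φ₁)`, and the Galois correspondence
(quadratic subfields of `K` ↔ index-2 subgroups of `𝒢` containing `H`).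
-/

namespace HodgeCM
namespace PerL34
namespace GaloisB3

open Equiv

/-! ### The model: `W(B₃) = C_{𝔖₆}(cc)` -/

/-- sign change at the first place: `φ₁ ↔ \bar φ₁`. -/
def f0 : Perm (Fin 6) := swap 0 3
/-- sign change at the second place. -/
def f1 : Perm (Fin 6) := swap 1 4
/-- sign change at the third place. -/
def f2 : Perm (Fin 6) := swap 2 5
/-- complex conjugation on embeddings: `i ↦ i + 3`. -/
def cc : Perm (Fin 6) := f0 * f1 * f2
/-- the rotation of the three places (a lift of the `3`-cycle of `𝔖₃`). -/
def rot : Perm (Fin 6) := swap 0 1 * swap 1 2 * swap 3 4 * swap 4 5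
/-- the transposition of places `2` and `3` (fixing the first place pointwise). -/
def s12 : Perm (Fin 6) := swap 1 2 * swap 4 5
/-- the transposition of places `1` and `3`. -/
def s02 : Perm (Fin 6) := swap 0 2 * swap 3 5
/-- the transposition of places `1` and `2`. -/
def s01 : Perm (Fin 6) := swap 0 1 * swap 3 4

/-- (Ported verbatim from the HodgeCMPerL package; no docstring in the source.) -/
theorem cc_apply (i : Fin 6) : cc i = i + 3 := by revert i; decide

/-- `W(B₃)`: the permutations of the six embeddings commuting with complex conjugation. -/
def W : Subgroup (Perm (Fin 6)) where
  carrier := {g | g * cc = cc * g}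
  one_mem' := by simp
  mul_mem' := by
    intro a b ha hb
    simp only [Set.mem_setOf_eq] at ha hb ⊢
    rw [mul_assoc, hb, ← mul_assoc, ha, mul_assoc]
  inv_mem' := by
    intro a ha
    simp only [Set.mem_setOf_eq] at ha ⊢
    have h : a⁻¹ * (a * cc) * a⁻¹ = a⁻¹ * (cc * a) * a⁻¹ := by rw [ha]
    rw [← mul_assoc, inv_mul_cancel, one_mul, mul_assoc, mul_assoc, mul_inv_cancel, mul_one] at h
    exact h.symm

/-- (Ported verbatim from the HodgeCMPerL package; no docstring in the source.) -/
theorem mem_W {g : Perm (Fin 6)} : g ∈ W ↔ g * cc = cc * g := Iff.rfl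

/-- (Ported verbatim from the HodgeCMPerL package; no docstring in the source.) -/
instance : DecidablePred (· ∈ W) := fun g => decidable_of_iff (g * cc = cc * g) mem_W.symm

/-- `|W(B₃)| = 48`. -/
theorem card_W : Nat.card W = 48 := by
  rw [Nat.card_eq_fintype_card]
  decide

/-- (Ported verbatim from the HodgeCMPerL package; no docstring in the source.) -/
theorem cc_mem_W : cc ∈ W := by decide
/-- (Ported verbatim from the HodgeCMPerL package; no docstring in the source.) -/
theorem f0_mem_W : f0 ∈ W := by decide
/-- (Ported verbatim from the HodgeCMPerL package; no docstring in the source.) -/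
theorem f1_mem_W : f1 ∈ W := by decide
/-- (Ported verbatim from the HodgeCMPerL package; no docstring in the source.) -/
theorem f2_mem_W : f2 ∈ W := by decide
/-- (Ported verbatim from the HodgeCMPerL package; no docstring in the source.) -/
theorem rot_mem_W : rot ∈ W := by decide
/-- (Ported verbatim from the HodgeCMPerL package; no docstring in the source.) -/
theorem s12_mem_W : s12 ∈ W := by decide
/-- (Ported verbatim from the HodgeCMPerL package; no docstring in the source.) -/
theorem s02_mem_W : s02 ∈ W := by decide
/-- (Ported verbatim from the HodgeCMPerL package; no docstring in the source.) -/
theorem s01_mem_W : s01 ∈ W := by decide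

/-- `cc` is central in `W` (by definition of `W`). -/
theorem cc_central {g : Perm (Fin 6)} (hg : g ∈ W) : g * cc = cc * g := hg

/-! ### [Y1neg] Lemma 7.1(a), the part used: `{±1}³ ≤ 𝒢` -/

/-- (Ported verbatim from the HodgeCMPerL package; no docstring in the source.) -/
theorem f0_eq : f0 = cc * ((f1 * s12) * (f1 * s12)) := by decide
/-- (Ported verbatim from the HodgeCMPerL package; no docstring in the source.) -/
theorem f1_eq : f1 = cc * ((f0 * s02) * (f0 * s02)) := by decide
/-- (Ported verbatim from the HodgeCMPerL package; no docstring in the source.) -/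
theorem f2_eq : f2 = cc * ((f0 * s01) * (f0 * s01)) := by decide

/-- In a subgroup `𝒢 ≤ W(B₃)` of order `24` or `48`, every square of `W(B₃)` lies in `𝒢`. -/
theorem sq_mem (𝒢 : Subgroup (Perm (Fin 6))) (hW : 𝒢 ≤ W) (hcard : Nat.card 𝒢 = 24 ∨ Nat.card 𝒢 = 48)
    {w : Perm (Fin 6)} (hw : w ∈ W) : w * w ∈ 𝒢 := by
  rcases hcard with h24 | h48
  · have hidx : (𝒢.subgroupOf W).index = 2 := by
      have h1 := (𝒢.subgroupOf W).card_mul_index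
      have h2 : Nat.card (𝒢.subgroupOf W) = 24 := by
        rw [Nat.card_congr (Subgroup.subgroupOfEquivOfLe hW).toEquiv]; exact h24
      rw [h2, card_W] at h1
      omega
    have h := Subgroup.mul_self_mem_of_index_two hidx ⟨w, hw⟩
    rw [Subgroup.mem_subgroupOf] at h
    exact h
  · have hEq : 𝒢 = W := Subgroup.eq_of_le_of_card_ge hW (by rw [h48, card_W])
    rw [hEq]
    exact W.mul_mem hw hw

/-- **[Y1neg] L7.1(a) (core).** A subgroup `𝒢 ≤ W(B₃)` containing complex conjugation and of order `24` or `48`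
contains the three sign changes: `N = 𝒢 ∩ {±1}³ = {±1}³`. -/
theorem flips_mem (𝒢 : Subgroup (Perm (Fin 6))) (hW : 𝒢 ≤ W) (hc : cc ∈ 𝒢)
    (hcard : Nat.card 𝒢 = 24 ∨ Nat.card 𝒢 = 48) : f0 ∈ 𝒢 ∧ f1 ∈ 𝒢 ∧ f2 ∈ 𝒢 := by
  refine ⟨?_, ?_, ?_⟩
  · rw [f0_eq]; exact 𝒢.mul_mem hc (sq_mem 𝒢 hW hcard (W.mul_mem f1_mem_W s12_mem_W))
  · rw [f1_eq]; exact 𝒢.mul_mem hc (sq_mem 𝒢 hW hcard (W.mul_mem f0_mem_W s02_mem_W))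
  · rw [f2_eq]; exact 𝒢.mul_mem hc (sq_mem 𝒢 hW hcard (W.mul_mem f0_mem_W s01_mem_W))

/-- The rotation of places also lies in every such `𝒢` (`rot = (rot²)²` and `rot² ∈ 𝒢` is a square). -/
theorem rot_mem (𝒢 : Subgroup (Perm (Fin 6))) (hW : 𝒢 ≤ W) (hcard : Nat.card 𝒢 = 24 ∨ Nat.card 𝒢 = 48) :
    rot ∈ 𝒢 := by
  have h : rot = (rot * rot) * (rot * rot) := by decide
  rw [h]
  exact 𝒢.mul_mem (sq_mem 𝒢 hW hcard rot_mem_W) (sq_mem 𝒢 hW hcard rot_mem_W)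

/-! ### CM types of `K` and the primitivity step `H' = H` -/

/-- `Φ ⊆ Hom(K,ℂ)` is a CM type: exactly one of each conjugate pair. -/
def IsCMType (Φ : Finset (Fin 6)) : Prop := ∀ a : Fin 6, a ∈ Φ ↔ cc a ∉ Φ

/-- (Ported verbatim from the HodgeCMPerL package; no docstring in the source.) -/
instance : DecidablePred IsCMType := fun Φ => by unfold IsCMType; infer_instance

/-- The finite heart: a member of a CM type `Φ ∋ 0` whose images under both sign changes `f1, f2` stay in `Φ`
is the base point. -/
theorem eq_zero_of_flips (Φ : Finset (Fin 6)) (hΦ : IsCMType Φ) (h0 : (0 : Fin 6) ∈ Φ) (y : Fin 6)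
    (hy : y ∈ Φ) (h1 : f1 y ∈ Φ) (h2 : f2 y ∈ Φ) : y = 0 := by
  revert y; revert Φ; decide

/-- **Primitivity ⇒ `H' = H`.**  If `𝒢 ∋ f1, f2`, then for a CM type `Φ ∋ φ₁` the right stabiliser of
`\widetilde Φ = {g : g(φ₁) ∈ Φ}` inside `𝒢` is the stabiliser of `φ₁`. -/
theorem rstab_iff_fix {𝒢 : Subgroup (Perm (Fin 6))} (h1 : f1 ∈ 𝒢) (h2 : f2 ∈ 𝒢)
    {Φ : Finset (Fin 6)} (hΦ : IsCMType Φ) (h0 : (0 : Fin 6) ∈ Φ) (u : Perm (Fin 6)) :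
    (∀ x ∈ 𝒢, (x * u) 0 ∈ Φ ↔ x 0 ∈ Φ) ↔ u 0 = 0 := by
  constructor
  · intro h
    have a := (h 1 𝒢.one_mem).mpr (by simpa using h0)
    have e1 : f1 0 = 0 := by decide
    have e2 : f2 0 = 0 := by decide
    have b := (h f1 h1).mpr (by rw [e1]; exact h0)
    have c := (h f2 h2).mpr (by rw [e2]; exact h0)
    simp only [Perm.mul_apply, Perm.one_apply] at a b c
    exact eq_zero_of_flips Φ hΦ h0 (u 0) a b c
  · intro hu x _
    simp [Perm.mul_apply, hu]

/-- `\widetilde Φ ⊆ 𝒢` as a subset of the group `𝒢`. -/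
def tilde (𝒢 : Subgroup (Perm (Fin 6))) (Φ : Finset (Fin 6)) : Set 𝒢 := {g | (g : Perm (Fin 6)) 0 ∈ Φ}

/-- (Ported verbatim from the HodgeCMPerL package; no docstring in the source.) -/
theorem cc_mul_cc : cc * cc = 1 := by decide

/-- The hypotheses of the A11 port hold in the model: `\widetilde Φ` is a CM type of `L` for the central involution
`c = cc` (A11 `RfwfReflex.IsCMType`) … -/
theorem isCMType_tilde {𝒢 : Subgroup (Perm (Fin 6))} (hc : cc ∈ 𝒢) {Φ : Finset (Fin 6)} (hΦ : IsCMType Φ) :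
    HodgeCM.Prior.ReflexLemma.RfwfReflex.IsCMType (⟨cc, hc⟩ : 𝒢) (tilde 𝒢 Φ) := by
  intro g
  show (g : Perm (Fin 6)) 0 ∈ Φ ↔ ¬ (cc * (g : Perm (Fin 6))) 0 ∈ Φ
  rw [Perm.mul_apply]
  exact hΦ _

/-- … it contains `1` (i.e. `φ₁ ∈ Φ_t`) … -/
theorem one_mem_tilde (𝒢 : Subgroup (Perm (Fin 6))) {Φ : Finset (Fin 6)} (h0 : (0 : Fin 6) ∈ Φ) :
    (1 : 𝒢) ∈ tilde 𝒢 Φ := by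
  show ((1 : 𝒢) : Perm (Fin 6)) 0 ∈ Φ
  simpa using h0

/-- … and `c` is central with `c² = 1` in `𝒢 ≤ W`. -/
theorem cc_central_sub {𝒢 : Subgroup (Perm (Fin 6))} (hW : 𝒢 ≤ W) (hc : cc ∈ 𝒢) (g : 𝒢) :
    (⟨cc, hc⟩ : 𝒢) * g = g * ⟨cc, hc⟩ := by
  apply Subtype.ext
  show cc * (g : Perm (Fin 6)) = (g : Perm (Fin 6)) * cc
  exact (hW g.2).symm

/-- `H = Gal(L/K)` = the stabiliser of `φ₁` in `𝒢`. -/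
def stabBase (𝒢 : Subgroup (Perm (Fin 6))) : Subgroup 𝒢 :=
  (MulAction.stabilizer (Perm (Fin 6)) (0 : Fin 6)).subgroupOf 𝒢

/-- (Ported verbatim from the HodgeCMPerL package; no docstring in the source.) -/
theorem mem_stabBase {𝒢 : Subgroup (Perm (Fin 6))} {g : 𝒢} : g ∈ stabBase 𝒢 ↔ (g : Perm (Fin 6)) 0 = 0 := by
  simp [stabBase, Subgroup.mem_subgroupOf, MulAction.mem_stabilizer_iff, Perm.smul_def]

open HodgeCM.Prior.ReflexLemma.RfwfReflex in
/-- **PerL L2.1(b), the cited step, in the vocabulary of the A11 port:** the right-stabiliser subgroup `H'` of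
`Θ = \widetilde Φ_t` (`RfwfReflex.rightStab`) IS `H`; hence the port's `K' = L^{H'}` is `K`. -/
theorem rightStab_tilde_eq {𝒢 : Subgroup (Perm (Fin 6))} (h1 : f1 ∈ 𝒢) (h2 : f2 ∈ 𝒢)
    {Φ : Finset (Fin 6)} (hΦ : IsCMType Φ) (h0 : (0 : Fin 6) ∈ Φ) :
    rightStab (tilde 𝒢 Φ) = stabBase 𝒢 := by
  ext u
  rw [mem_rightStab, mem_stabBase]
  unfold RStab tilde
  simp only [Set.mem_setOf_eq, Subgroup.coe_mul]
  rw [← rstab_iff_fix h1 h2 hΦ h0 (u : Perm (Fin 6))]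
  constructor
  · intro h x hx; exact h ⟨x, hx⟩
  · intro h x; exact h x x.2

/-- The same for every `𝒢` as in the dictionary (order `24` or `48`, containing `cc`), every CM type `Φ ∋ φ₁`. -/
theorem rightStab_tilde_eq_of_card (𝒢 : Subgroup (Perm (Fin 6))) (hW : 𝒢 ≤ W) (hc : cc ∈ 𝒢)
    (hcard : Nat.card 𝒢 = 24 ∨ Nat.card 𝒢 = 48) {Φ : Finset (Fin 6)} (hΦ : IsCMType Φ) (h0 : (0 : Fin 6) ∈ Φ) :
    HodgeCM.Prior.ReflexLemma.RfwfReflex.rightStab (tilde 𝒢 Φ) = stabBase 𝒢 :=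
  rightStab_tilde_eq (flips_mem 𝒢 hW hc hcard).2.1 (flips_mem 𝒢 hW hc hcard).2.2 hΦ h0

/-! ### "`K` contains no imaginary quadratic field": no index-two subgroup of `𝒢` above `H` -/

/-- The words `f0^a f1^b f2^c rot^k`. -/
def word (v : Fin 2 × Fin 2 × Fin 2 × Fin 3) : Perm (Fin 6) :=
  f0 ^ (v.1 : ℕ) * f1 ^ (v.2.1 : ℕ) * f2 ^ (v.2.2.1 : ℕ) * rot ^ (v.2.2.2 : ℕ)

/-- The words `f0^a f1^b f2^c rot^k s12^e`. -/
def word' (v : (Fin 2 × Fin 2 × Fin 2 × Fin 3) × Fin 2) : Perm (Fin 6) :=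
  word v.1 * s12 ^ (v.2 : ℕ)

/-- (Ported verbatim from the HodgeCMPerL package; no docstring in the source.) -/
theorem card_words : (Finset.univ.image word).card = 24 := by decide
set_option maxRecDepth 20000 in
/-- (Ported verbatim from the HodgeCMPerL package; no docstring in the source.) -/
theorem card_words' : (Finset.univ.image word').card = 48 := by decide

/-- (Ported verbatim from the HodgeCMPerL package; no docstring in the source.) -/
theorem le_card_of_subset {M : Subgroup (Perm (Fin 6))} (S : Finset (Perm (Fin 6))) (hS : ∀ s ∈ S, s ∈ M) :
    S.card ≤ Nat.card M := by
  have hsub : ((S : Set (Perm (Fin 6)))) ⊆ (M : Set (Perm (Fin 6))) := fun g hg => hS g hg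
  have h := Set.ncard_le_ncard hsub (Set.toFinite _)
  rw [Set.ncard_coe_finset] at h
  have hc : Nat.card M = (M : Set (Perm (Fin 6))).ncard := Nat.card_coe_set_eq (M : Set (Perm (Fin 6)))
  omega

/-- (Ported verbatim from the HodgeCMPerL package; no docstring in the source.) -/
theorem words_le_card {M : Subgroup (Perm (Fin 6))} (hf0 : f0 ∈ M) (hf1 : f1 ∈ M) (hf2 : f2 ∈ M) (hrot : rot ∈ M) :
    24 ≤ Nat.card M := by
  rw [← card_words]
  apply le_card_of_subset
  intro s hs
  simp only [Finset.mem_image, Finset.mem_univ, true_and] at hs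
  obtain ⟨v, rfl⟩ := hs
  exact M.mul_mem (M.mul_mem (M.mul_mem (M.pow_mem hf0 _) (M.pow_mem hf1 _)) (M.pow_mem hf2 _)) (M.pow_mem hrot _)

/-- (Ported verbatim from the HodgeCMPerL package; no docstring in the source.) -/
theorem words'_le_card {M : Subgroup (Perm (Fin 6))} (hf0 : f0 ∈ M) (hf1 : f1 ∈ M) (hf2 : f2 ∈ M) (hrot : rot ∈ M)
    (hs : s12 ∈ M) : 48 ≤ Nat.card M := by
  rw [← card_words']
  apply le_card_of_subset
  intro s hs'
  simp only [Finset.mem_image, Finset.mem_univ, true_and] at hs'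
  obtain ⟨v, rfl⟩ := hs'
  exact M.mul_mem
    (M.mul_mem (M.mul_mem (M.mul_mem (M.pow_mem hf0 _) (M.pow_mem hf1 _)) (M.pow_mem hf2 _)) (M.pow_mem hrot _))
    (M.pow_mem hs _)

/-- **[Y1neg] L7.1(b), "`K` contains no imaginary quadratic field" (equivalently, by the Galois correspondence, no
index-two subgroup `M` of `𝒢 = Gal(L/ℚ)` contains `H = Gal(L/K) = Stab(φ₁)`).** -/
theorem no_index_two_over_stab (𝒢 : Subgroup (Perm (Fin 6))) (hW : 𝒢 ≤ W) (hc : cc ∈ 𝒢)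
    (hcard : Nat.card 𝒢 = 24 ∨ Nat.card 𝒢 = 48) (M : Subgroup (Perm (Fin 6))) (hM : M ≤ 𝒢)
    (hstab : ∀ g ∈ 𝒢, g 0 = 0 → g ∈ M) (hidx : Nat.card M * 2 = Nat.card 𝒢) : False := by
  obtain ⟨-, hf1𝒢, hf2𝒢⟩ := flips_mem 𝒢 hW hc hcard
  have hf1 : f1 ∈ M := hstab f1 hf1𝒢 (by decide)
  have hf2 : f2 ∈ M := hstab f2 hf2𝒢 (by decide)
  have hidx2 : (M.subgroupOf 𝒢).index = 2 := by
    have h1 := (M.subgroupOf 𝒢).card_mul_index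
    have h2 : Nat.card (M.subgroupOf 𝒢) = Nat.card M := Nat.card_congr (Subgroup.subgroupOfEquivOfLe hM).toEquiv
    rw [h2, ← hidx] at h1
    have hpos : 0 < Nat.card M := Nat.card_pos
    exact Nat.eq_of_mul_eq_mul_left hpos h1
  have hsq : ∀ g ∈ 𝒢, g * g ∈ M := fun g hg => by
    have h := Subgroup.mul_self_mem_of_index_two hidx2 ⟨g, hg⟩
    rwa [Subgroup.mem_subgroupOf] at h
  have hrot : rot ∈ M := by
    have h : rot = (rot * rot) * (rot * rot) := by decide
    rw [h]
    exact M.mul_mem (hsq rot (rot_mem 𝒢 hW hcard)) (hsq rot (rot_mem 𝒢 hW hcard))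
  have hf0 : f0 ∈ M := by
    have h : f0 = rot * f2 * rot⁻¹ := by decide
    rw [h]
    exact M.mul_mem (M.mul_mem hrot hf2) (M.inv_mem hrot)
  have h24 : 24 ≤ Nat.card M := words_le_card hf0 hf1 hf2 hrot
  rcases hcard with h | h
  · omega
  · have hEq : 𝒢 = W := Subgroup.eq_of_le_of_card_ge hW (by rw [h, card_W])
    have hs12 : s12 ∈ M := hstab s12 (by rw [hEq]; exact s12_mem_W) (by decide)
    have h48 : 48 ≤ Nat.card M := words'_le_card hf0 hf1 hf2 hrot hs12
    omega

set_option maxRecDepth 20000 in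
/-- **[Y1neg] L7.1(c)/(b) count: `|H| = 4` resp. `8`** — the stabiliser of `φ₁` in `W(B₃)` has `8` elements and in
`{±1}³ ⋊ A₃` it is `{1, f1, f2, f1 f2}`; recorded here as the two finite facts actually quotable:
`|Stab_W(0)| = 8` and, for any `𝒢` as above of order `24`, `Stab_𝒢(0) ⊇ {1, f1, f2, f1 f2}` (from `flips_mem`). -/
theorem card_stab_W : (Finset.univ.filter (fun g : Perm (Fin 6) => g ∈ W ∧ g 0 = 0)).card = 8 := by decide

/-! ### [Y1neg] L7.1(a) in full: the two possible groups, as explicit sets of permutations -/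

/-- `[L:ℚ] = 48`: `𝒢` is all of `W(B₃)`. -/
theorem eq_W_of_card (𝒢 : Subgroup (Perm (Fin 6))) (hW : 𝒢 ≤ W) (h48 : Nat.card 𝒢 = 48) : 𝒢 = W :=
  Subgroup.eq_of_le_of_card_ge hW (by rw [h48, card_W])

/-- `[L:ℚ] = 24`: `𝒢` is exactly `{±1}³ ⋊ ℤ/3 = {f0^a f1^b f2^c rot^k}` (24 explicit permutations). -/
theorem coe_eq_words_of_card (𝒢 : Subgroup (Perm (Fin 6))) (hW : 𝒢 ≤ W) (hc : cc ∈ 𝒢) (h24 : Nat.card 𝒢 = 24) :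
    (𝒢 : Set (Perm (Fin 6))) = ↑(Finset.univ.image word) := by
  obtain ⟨hf0, hf1, hf2⟩ := flips_mem 𝒢 hW hc (Or.inl h24)
  have hrot := rot_mem 𝒢 hW (Or.inl h24)
  symm
  apply Set.eq_of_subset_of_ncard_le _ _ (Set.toFinite _)
  · intro g hg
    simp only [Finset.coe_image, Finset.coe_univ, Set.image_univ, Set.mem_range] at hg
    obtain ⟨v, rfl⟩ := hg
    exact 𝒢.mul_mem (𝒢.mul_mem (𝒢.mul_mem (𝒢.pow_mem hf0 _) (𝒢.pow_mem hf1 _)) (𝒢.pow_mem hf2 _)) (𝒢.pow_mem hrot _)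
  · have h1 : (𝒢 : Set (Perm (Fin 6))).ncard = 24 := by rw [← Nat.card_coe_set_eq]; exact h24
    rw [h1, Set.ncard_coe_finset, card_words]

end GaloisB3
end PerL34
end HodgeCM
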